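import Summits.PneNP.PneNP.Theorems.ChebyshevTracialDesignCrossingPlaneExpTools
import HarnessLib

/-!
# Cell pnp-psdrank, route `ChebyshevTracialDesign`: numeric tools for the asymptotic form of the γ-direction
# value bound — brick 143b (crux `TracialDecayExp20`, stmt-PneNP-19878)

Brick 143b (prover g29; MEMO-31 §6). Pure real / integer bookkeeping consumed by brick 143
(`ChebyshevTracialDesignGammaDirectionExp`), which turns brick 142's per-matching γ-direction bound
(`…GammaDirectionDischarged.gammaDirection_value_le_discharged`: bricks 129/134's remainders at the `x`-smoothness family
plus `2^{D+1}·G·(2n+3t)²` times the law mass off the window set `B`) into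
`|PM|·Σ_U W(U,M)·ψ(|U∩H|)·C_{γ,λ,κ}(U)² ≤ 2·10⁴·(1+B_v)·G·n⁶·e^{−a′D}` for `n ≥ n₀(β, a′)`:

* §1 `chernoff_exponent_le_four` — brick 126b's `chernoff_exponent_le` for brick 132's exponent (margin `(t−T−4)/2` in place of
  `(t−T−2)/2`, the denominator `N − T − 2` kept): `≤ −β₀N/32` once `T + 4 ≤ β₀N`, `T + 4 ≤ N/16`; `num_four'` (`T+4 ≤ P⁴/32`).
* §2 `le_abs_of_not_mem_window` — the window set of brick 141 is `B = {y ∈ [y₀, t] : |y − μ| < ε}` with a FLOOR `y₀ = 2D+4`;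
  once `y₀ ≤ μ − ε`, every `x ∈ [0,t] ∖ B` has `|x − μ| ≥ ε` (so `ShellLawTail` prices `[0,t] ∖ B`).
* §3 `tail_le` — `2^{D+1}·G·(2n+3t)²·((D+1)·2(n/2+1)³·e^{−(K√(hD))²/h}) ≤ 100·G·n⁶·e^{−a′D}` for `K² = a′ + log 2`, `t ≤ n`.
* §4 `final_bound_gamma` — `300t²G((2D+1)+B_vC_b)(Ξ₁+Ξ₂) + tail ≤ 2·10⁴(1+B_v)Gn⁶e` (brick 126's `final_bound` with `300` and
  the `100`-tail).
READING: bookkeeping only. WHAT THIS FILE DOES NOT DO: anything combinatorial; anything on `TracialDecayExp20` itself, psd rank of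
P_PM(K_n), or P vs NP. [cite: Rothvoss2017, §2 (PDF p. 6)] [cite: RollinRoss2010, §4.1 Thm 4.2] [cite: Durrett2019, §2.7]
Stature: support/instrument (kernel lane, no defs, axioms standard). Supports stmt-PneNP-19878.
-/

set_option linter.dupNamespace false -- `Summit.PneNP.PneNP.…`: summit = sub-problem (D-0017)

noncomputable section

namespace Summit.PneNP.PneNP.Theorems.ChebyshevTracialDesignGammaDirectionExpTools

open Finset Real
open Summit.PneNP.PneNP.Theorems.ChebyshevTracialDesignCrossingPlaneExpTools (chernoff_exponent_le)

/-! ### §1 The Chernoff exponent of brick 132 -/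

/-- **The Chernoff exponent in the non-aligned window, `T+4` margin** (brick 132's exponent): with `u = β₀ ≤ 1/8`, `0 ≤ a ≤ N/2 − β₀N`,
`T + 4 ≤ β₀N`, `T + 4 ≤ N/16`, `N/2 ≤ t`, `r₀ < β₀N/2 + 1`:
`(β₀+β₀²)·(t/2·a/(N−T−2)) − β₀·((t−T−4)/2 + 1 − r₀) ≤ −β₀N/32` (brick 126b's `chernoff_exponent_le` at `T+2`, then the
denominator `N−T−4 ↦ N−T−2`). [cite: Durrett2019, §2.7] -/
theorem chernoff_exponent_le_four {β₀ a N T tt r₀ : ℝ} (hβ₀ : 0 < β₀) (hβ₀8 : β₀ ≤ 1 / 8) (ha0 : 0 ≤ a)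
    (ha : a ≤ N / 2 - β₀ * N) (hT0 : 0 ≤ T) (hT : T + 4 ≤ β₀ * N) (hT' : T + 4 ≤ N / 16) (htt : N / 2 ≤ tt)
    (hr₀ : r₀ < β₀ * N / 2 + 1) :
    (β₀ + β₀ ^ 2) * (tt / 2 * a / (N - T - 2)) - β₀ * ((tt - T - 4) / 2 + 1 - r₀) ≤ -(β₀ * N / 32) := by
  have h := chernoff_exponent_le (T := T + 2) hβ₀ hβ₀8 ha (by linarith) (by linarith) (by linarith) htt hr₀
  have hN4 : 0 < N - (T + 2) - 2 := by linarith
  have htt0 : 0 ≤ tt := by linarith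
  have hmono : tt / 2 * a / (N - T - 2) ≤ tt / 2 * a / (N - (T + 2) - 2) :=
    div_le_div_of_nonneg_left (by positivity) hN4 (by linarith)
  have h1 := mul_le_mul_of_nonneg_left hmono (show 0 ≤ β₀ + β₀ ^ 2 by positivity)
  have e : (tt - (T + 2) - 2) / 2 + 1 - r₀ = (tt - T - 4) / 2 + 1 - r₀ := by ring
  rw [e] at h
  linarith

/-- (4′) `T+4 ≤ 8P² ≤ P⁴/32` once `P ≥ 16` (`T ≤ 7P²`; the `T+4` margin of `chernoff_exponent_le_four`).
[cite: RollinRoss2010, §4.1 Thm 4.2] -/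
theorem num_four' {P T : ℝ} (hP : 16 ≤ P) (hTP : T ≤ 7 * P ^ 2) : T + 4 ≤ P ^ 4 / 32 := by
  have hP2 : 256 ≤ P ^ 2 := by nlinarith
  have hP4 : P ^ 4 = P ^ 2 * P ^ 2 := by ring
  rw [hP4]; nlinarith

/-! ### §2 The window set with a floor -/

/-- **Off the floored window, the deviation is at least `ε`.** If `x ∈ [0,t]` is not in
`B = {y ∈ [y₀,t] : |y − μ| < ε}` and the floor satisfies `y₀ ≤ μ − ε`, then `ε ≤ |x − μ|`.
[cite: Rothvoss2017, §2 (PDF p. 6)] -/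
theorem le_abs_of_not_mem_window {x t y₀ : ℤ} {μ ε : ℝ} (hx : x ∈ Icc (0 : ℤ) t)
    (hB : x ∉ (Icc y₀ t).filter (fun y : ℤ => |(y : ℝ) - μ| < ε)) (hy₀ : (y₀ : ℝ) ≤ μ - ε) :
    ε ≤ |(x : ℝ) - μ| := by
  by_cases hxy : y₀ ≤ x
  · have hx' : x ∈ Icc y₀ t := mem_Icc.2 ⟨hxy, (mem_Icc.1 hx).2⟩
    by_contra hlt
    exact hB (mem_filter.2 ⟨hx', lt_of_not_ge hlt⟩)
  · have hlt : (x : ℝ) < y₀ := by exact_mod_cast lt_of_not_ge hxy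
    have h1 : ε ≤ μ - x := by linarith
    exact h1.trans (by rw [abs_sub_comm]; exact le_abs_self _)

/-- The floored window set lies in `[y₀, t]` and inside the window: membership unpacked.
[cite: Rothvoss2017, §2 (PDF p. 6)] -/
theorem mem_window {y t y₀ : ℤ} {μ ε : ℝ} (hy : y ∈ (Icc y₀ t).filter (fun y : ℤ => |(y : ℝ) - μ| < ε)) :
    (y₀ ≤ y ∧ y ≤ t) ∧ |(y : ℝ) - μ| < ε := by
  obtain ⟨h1, h2⟩ := mem_filter.1 hy
  exact ⟨mem_Icc.1 h1, h2⟩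

/-! ### §3 The tail in exponential form -/

/-- `2^{D+1}·e^{−(a′ + log 2)·D} = 2·e^{−a′D}`. [cite: Durrett2019, §2.7] -/
theorem two_pow_mul_exp_eq {a' : ℝ} (D : ℕ) :
    (2 : ℝ) ^ (D + 1) * Real.exp (-((a' + Real.log 2) * D)) = 2 * Real.exp (-(a' * D)) := by
  have h2D : (2 : ℝ) ^ D = Real.exp (((D : ℕ) : ℝ) * Real.log 2) := by
    rw [Real.exp_nat_mul, Real.exp_log (by norm_num)]
  rw [pow_succ, h2D, show -((a' + Real.log 2) * D) = -(a' * D) + -(((D : ℕ) : ℝ) * Real.log 2) by ring,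
    Real.exp_add, Real.exp_neg (((D : ℕ) : ℝ) * Real.log 2)]
  have : Real.exp (((D : ℕ) : ℝ) * Real.log 2) ≠ 0 := (Real.exp_pos _).ne'
  field_simp

/-- **The tail of brick 142 in exponential form.** With `K² = a′ + log 2`, `h > 0` (`h = |H|`), `t ≤ n`, `D + 1 ≤ n`, `4 ≤ n`:
`2^{D+1}·G·(2n+3t)²·((D+1)·2(n/2+1)³·e^{−(K√(hD))²/h}) ≤ 100·G·n⁶·e^{−a′D}`. [cite: Durrett2019, §2.7] -/
theorem tail_le {K a' h G nn tt : ℝ} {D : ℕ} (hK2 : K ^ 2 = a' + Real.log 2) (hh : 0 < h) (hG : 0 ≤ G)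
    (htt0 : 0 ≤ tt) (htt : tt ≤ nn) (hD1n : (D : ℝ) + 1 ≤ nn) (hn4 : 4 ≤ nn) :
    (2 : ℝ) ^ (D + 1) * G * (2 * nn + 3 * tt) ^ 2 *
        (((D : ℝ) + 1) * (2 * (nn / 2 + 1) ^ 3 * Real.exp (-((K * Real.sqrt (h * D)) ^ 2 / h)))) ≤
      100 * G * nn ^ 6 * Real.exp (-(a' * D)) := by
  have hD0 : (0 : ℝ) ≤ D := Nat.cast_nonneg _
  have e0 : (K * Real.sqrt (h * D)) ^ 2 / h = K ^ 2 * D := by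
    rw [mul_pow, Real.sq_sqrt (by positivity)]; field_simp
  rw [e0, hK2]
  have hn2' : nn / 2 + 1 ≤ nn := by linarith only [hn4]
  have hn20 : (0 : ℝ) ≤ nn / 2 + 1 := by linarith only [hn4]
  have h5 : (2 * nn + 3 * tt) ^ 2 ≤ (5 * nn) ^ 2 :=
    pow_le_pow_left₀ (by linarith only [htt0, hn4]) (by linarith only [htt]) 2
  calc (2 : ℝ) ^ (D + 1) * G * (2 * nn + 3 * tt) ^ 2 *
        (((D : ℝ) + 1) * (2 * (nn / 2 + 1) ^ 3 * Real.exp (-((a' + Real.log 2) * D))))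
      = G * (2 * nn + 3 * tt) ^ 2 * (((D : ℝ) + 1) * (2 * (nn / 2 + 1) ^ 3)) *
          ((2 : ℝ) ^ (D + 1) * Real.exp (-((a' + Real.log 2) * D))) := by ring
    _ = G * (2 * nn + 3 * tt) ^ 2 * (((D : ℝ) + 1) * (2 * (nn / 2 + 1) ^ 3)) * (2 * Real.exp (-(a' * D))) := by
          rw [two_pow_mul_exp_eq]
    _ ≤ G * (5 * nn) ^ 2 * (nn * (2 * nn ^ 3)) * (2 * Real.exp (-(a' * D))) := by gcongr
    _ = 100 * G * nn ^ 6 * Real.exp (-(a' * D)) := by ring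

/-! ### §4 The last arithmetic -/

/-- **Final arithmetic (γ-direction).** With `Ξ₁ ≤ e`, `C_b Ξ₁ ≤ 49ne`, `Ξ₂ ≤ e`, `C_b Ξ₂ ≤ e`, `2D+1 ≤ n`, `t ≤ n`, `1 ≤ n`,
`tail ≤ 100Gn⁶e`: `300t²G((2D+1) + B_vC_b)(Ξ₁+Ξ₂) + tail ≤ 2·10⁴(1+B_v)Gn⁶e`. [cite: RollinRoss2010, §4.1 Thm 4.2] -/
theorem final_bound_gamma {tt G Bv Cb Ξ₁ Ξ₂ e nn DD tail : ℝ} (htt0 : 0 ≤ tt) (hG : 0 ≤ G) (hBv : 0 ≤ Bv) (hCb : 0 ≤ Cb)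
    (hΞ₁ : 0 ≤ Ξ₁) (hΞ₂ : 0 ≤ Ξ₂) (he : 0 ≤ e) (hDD : 0 ≤ DD) (h1 : Ξ₁ ≤ e) (h2 : Cb * Ξ₁ ≤ 49 * nn * e)
    (h3 : Ξ₂ ≤ e) (h4 : Cb * Ξ₂ ≤ e) (hD : 2 * DD + 1 ≤ nn) (htt : tt ≤ nn) (hn : 1 ≤ nn)
    (htail : tail ≤ 100 * G * nn ^ 6 * e) :
    300 * tt ^ 2 * G * ((2 * DD + 1) + Bv * Cb) * (Ξ₁ + Ξ₂) + tail ≤ 2 * 10 ^ 4 * (1 + Bv) * G * nn ^ 6 * e := by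
  have k1 : (2 * DD + 1) * (Ξ₁ + Ξ₂) ≤ nn * (e + e) := mul_le_mul hD (add_le_add h1 h3) (by positivity) (by linarith)
  have k2 : Bv * Cb * (Ξ₁ + Ξ₂) ≤ Bv * (50 * nn * e) := by
    rw [mul_assoc]
    refine mul_le_mul_of_nonneg_left ?_ hBv
    have : e ≤ nn * e := le_mul_of_one_le_left he hn
    nlinarith
  have k3 : ((2 * DD + 1) + Bv * Cb) * (Ξ₁ + Ξ₂) ≤ (2 + 50 * Bv) * nn * e := by nlinarith
  have k4 : tt ^ 2 ≤ nn ^ 2 := pow_le_pow_left₀ htt0 htt 2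
  have k5 : 300 * tt ^ 2 * G * ((2 * DD + 1) + Bv * Cb) * (Ξ₁ + Ξ₂) ≤
      300 * nn ^ 2 * G * ((2 + 50 * Bv) * nn * e) := by
    have h0 : 0 ≤ ((2 * DD + 1) + Bv * Cb) * (Ξ₁ + Ξ₂) := by positivity
    calc 300 * tt ^ 2 * G * ((2 * DD + 1) + Bv * Cb) * (Ξ₁ + Ξ₂)
        = 300 * tt ^ 2 * G * (((2 * DD + 1) + Bv * Cb) * (Ξ₁ + Ξ₂)) := by ring
      _ ≤ 300 * nn ^ 2 * G * (((2 * DD + 1) + Bv * Cb) * (Ξ₁ + Ξ₂)) := by gcongr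
      _ ≤ 300 * nn ^ 2 * G * ((2 + 50 * Bv) * nn * e) := by gcongr
  have k6 : nn ^ 3 ≤ nn ^ 6 := pow_le_pow_right₀ hn (by norm_num)
  have k7 : 0 ≤ (600 + 15000 * Bv) * G * e := by positivity
  have k8 := mul_le_mul_of_nonneg_left k6 k7
  nlinarith [k5, k8, htail, mul_nonneg (mul_nonneg hG he) (pow_nonneg (by linarith : (0:ℝ) ≤ nn) 6),
    mul_nonneg (mul_nonneg hBv (mul_nonneg hG he)) (pow_nonneg (by linarith : (0:ℝ) ≤ nn) 6)]

end Summit.PneNP.PneNP.Theorems.ChebyshevTracialDesignGammaDirectionExpTools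

end
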